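import Mathlib.Analysis.Calculus.BumpFunction.InnerProduct
import Literature.Analysis.FluidPDE.ClassicalSuitableRegionEnergy
import Literature.Analysis.FluidPDE.DipolePotentialFlow
import HarnessLib

/-!
# Serrin's potential flows `u = a(t)∇φ(x)`: classical Navier–Stokes solutions for every harmonic `φ`,
# every amplitude `a` and every viscosity

Analysis/FluidPDE proofs-layer file (theorems only, no definitions, no new `Prop` facts) over the accepted
`IsClassicalNSSolutionOnRegion` (`ClassicalSolutionRegion.lean`), the bridge
`IsClassicalNSSolutionOnRegion.isSuitableWeakSolutionOn_of_subset` (`ClassicalSuitableRegionEnergy.lean`) and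
the gradient-field calculus of `DipolePotentialFlow.lean` (`convect_gradient_self`,
`laplacian_gradient_eq_zero`) / `PressurePoisson.lean` (`divergence_gradient`).

Serrin 1962 (ARMA 9, p. 187): for a harmonic function `φ` on a spatial domain `V` and ANY function of time
`a`, the pair `u(t,x) = a(t)∇φ(x)`, `p(t,x) = −a′(t)φ(x) − a(t)²|∇φ(x)|²/2` solves the Navier–Stokes (and
Euler) equations on `I × V` — `∂ₜu = a′∇φ`, `(u·∇)u = a²∇(½|∇φ|²)`, `Δu = a∇Δφ = 0`, `div u = aΔφ = 0`. It is
the standard example that weak solutions need not be smooth in time, that local/exterior backward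
uniqueness fails without decay or boundary data, and (with `φ = Γ`, `∂ₑΓ`, … and scale-invariant
amplitudes) the source of the exterior similarity modes used by the disprover of route item `ScarRigidity`
(stmt-NavierStokesRegularity-11717; files `PotentialFlowParabolicExterior.lean`,
`DipoleMomentFlowParabolicExterior.lean`).

* `exists_contDiff_eqOn_ball` — a function smooth on an open set agrees near each of its points with a
  globally smooth function (bump-function cut-off; used to apply the global `C²/C³` calculus lemmas);
* `harmonic_gradient_identities` — for `φ` smooth on an open `V` with `Δφ = 0` there: `∇φ` is smooth at
  every `x ∈ V`, `div ∇φ = 0`, `Δ∇φ = 0`, `(∇φ·∇)∇φ = ∇(½|∇φ|²)` at `x`;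
* `serrin_potentialFlow_isClassical` — **`(a(t)∇φ, −a′φ − a²|∇φ|²/2)` is a classical Navier–Stokes solution
  on `I × V` for every viscosity `ν`** (`I` open in time, `a` smooth on `I`);
* `serrin_potentialFlow_isSuitable` — hence a suitable weak solution on every open `Q ⊆ I × V` when `ν > 0`.

## References

* J. Serrin, *On the interior regularity of weak solutions of the Navier–Stokes equations*, Arch. Rational
  Mech. Anal. 9 (1962) 187–195, p. 187 (the example `u = a(t)∇h`). [Serrin1962]
-/

noncomputable section

open Set Filter Function MeasureTheory Metric TopologicalSpace
open scoped Topology ENNReal NNReal InnerProductSpace RealInnerProductSpace Laplacian ContDiff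

namespace Literature.Analysis.FluidPDE

/-- Local notation for physical space `ℝ³ = EuclideanSpace ℝ (Fin 3)`. -/
local notation "ℝ³" => EuclideanSpace ℝ (Fin 3)

/-- **Smooth local extension.** A function `C^∞` on an open set `V` agrees, on a ball around each point of
`V`, with a globally `C^∞` function (cut-off by a bump function supported in `V`). [folklore] -/
theorem exists_contDiff_eqOn_ball {V : Set ℝ³} (hV : IsOpen V) {φ : ℝ³ → ℝ} (hφ : ContDiffOn ℝ ∞ φ V)
    {x : ℝ³} (hx : x ∈ V) :
    ∃ θ : ℝ³ → ℝ, ContDiff ℝ ∞ θ ∧ ∃ r > 0, ball x r ⊆ V ∧ EqOn θ φ (ball x r) := by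
  obtain ⟨ε, hε, hball⟩ := Metric.isOpen_iff.1 hV x hx
  let χ : ContDiffBump x := ⟨ε / 4, ε / 2, by positivity, by linarith⟩
  refine ⟨fun y => χ y * φ y, ?_, ε / 4, by positivity, (ball_subset_ball (by linarith)).trans hball, ?_⟩
  · refine contDiff_iff_contDiffAt.2 fun y => ?_
    by_cases hy : y ∈ V
    · exact χ.contDiff.contDiffAt.mul (hφ.contDiffAt (hV.mem_nhds hy))
    · have hy' : y ∉ tsupport χ := by
        rw [χ.tsupport_eq]
        intro hy2
        exact hy (hball (closedBall_subset_ball (by show ε / 2 < ε; linarith) hy2))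
      have h0 : (χ : ℝ³ → ℝ) =ᶠ[𝓝 y] 0 := notMem_tsupport_iff_eventuallyEq.1 hy'
      have : (fun z => χ z * φ z) =ᶠ[𝓝 y] fun _ => (0 : ℝ) := by
        filter_upwards [h0] with z hz
        simp [hz]
      exact (contDiffAt_const (c := (0 : ℝ))).congr_of_eventuallyEq this
  · intro y hy
    show χ y * φ y = φ y
    rw [χ.one_of_mem_closedBall (mem_closedBall.2 (le_of_lt (mem_ball.1 hy))), one_mul]

/-- **The gradient of a harmonic function is an exact steady potential flow**: for `φ` smooth on an open
`V` with `Δφ = 0` on `V` and `x ∈ V`, the field `∇φ` is smooth at `x` and `div ∇φ (x) = 0`,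
`Δ ∇φ (x) = 0`, `((∇φ·∇)∇φ)(x) = ∇(½|∇φ|²)(x)`. [folklore] -/
theorem harmonic_gradient_identities {V : Set ℝ³} (hV : IsOpen V) {φ : ℝ³ → ℝ} (hφ : ContDiffOn ℝ ∞ φ V)
    (hΔ : ∀ x ∈ V, Δ φ x = 0) {x : ℝ³} (hx : x ∈ V) :
    ContDiffAt ℝ ∞ (gradient φ) x ∧ VectorCalculus.divergence (gradient φ) x = 0 ∧ Δ (gradient φ) x = 0 ∧
      convect (gradient φ) (gradient φ) x = gradient (fun y => 2⁻¹ * ‖gradient φ y‖ ^ 2) x := by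
  obtain ⟨θ, hθ, r, hr, hrV, heq⟩ := exists_contDiff_eqOn_ball hV hφ hx
  have hloc : ∀ y ∈ ball x r, φ =ᶠ[𝓝 y] θ := fun y hy =>
    Filter.eventuallyEq_of_mem (isOpen_ball.mem_nhds hy) fun z hz => (heq hz).symm
  have hgrad : gradient φ =ᶠ[𝓝 x] gradient θ := by
    filter_upwards [isOpen_ball.mem_nhds (mem_ball_self hr)] with y hy
    show (InnerProductSpace.toDual ℝ ℝ³).symm (fderiv ℝ φ y) =
      (InnerProductSpace.toDual ℝ ℝ³).symm (fderiv ℝ θ y)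
    rw [(hloc y hy).fderiv_eq]
  have hΔθ : Δ θ =ᶠ[𝓝 x] fun _ => (0 : ℝ) := by
    filter_upwards [isOpen_ball.mem_nhds (mem_ball_self hr)] with y hy
    rw [← (InnerProductSpace.laplacian_congr_nhds (hloc y hy)).eq_of_nhds]
    exact hΔ y (hrV hy)
  have h2 : ContDiff ℝ 2 θ := contDiff_infty.1 hθ 2
  have h3 : ContDiff ℝ 3 θ := contDiff_infty.1 hθ 3
  have hgθ : ContDiff ℝ ∞ (gradient θ) :=
    (InnerProductSpace.toDual ℝ ℝ³).symm.contDiff.comp (hθ.fderiv_right (ENat.coe_top_add_one).le)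
  refine ⟨hgθ.contDiffAt.congr_of_eventuallyEq hgrad, ?_, ?_, ?_⟩
  · rw [VectorCalculus.divergence, hgrad.fderiv_eq, ← VectorCalculus.divergence, divergence_gradient h2 x,
      hΔθ.eq_of_nhds]
  · rw [(InnerProductSpace.laplacian_congr_nhds hgrad).eq_of_nhds]
    exact laplacian_gradient_eq_zero h3 hΔθ
  · have hsq : (fun y => 2⁻¹ * ‖gradient φ y‖ ^ 2) =ᶠ[𝓝 x] fun y => 2⁻¹ * ‖gradient θ y‖ ^ 2 := by
      filter_upwards [hgrad] with y hy
      rw [hy]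
    rw [convect, hgrad.fderiv_eq, hgrad.eq_of_nhds, ← convect, convect_gradient_self h2 x]
    show _ = (InnerProductSpace.toDual ℝ ℝ³).symm (fderiv ℝ (fun y => 2⁻¹ * ‖gradient φ y‖ ^ 2) x)
    rw [hsq.fderiv_eq]
    rfl

/-- **Serrin's potential flows are classical Navier–Stokes solutions, for every viscosity** (Serrin 1962,
p. 187: "if `h` is harmonic and `a(t)` arbitrary, `u = a(t)∇h` is a solution with pressure
`p = −a′h − ½a²|∇h|²`"): on `I × V` (`I` open in time, `V` open in space), for `φ` smooth and harmonic on `V`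
and `a` smooth on `I`, the pair `u(t,x) = a(t) • ∇φ(x)`, `p(t,x) = −a′(t)φ(x) − a(t)²|∇φ(x)|²/2` satisfies
`∂ₜu + (u·∇)u = νΔu − ∇p`, `div u = 0` classically. [cite: Serrin1962, p. 187 (the example u = a(t)∇h)] -/
theorem serrin_potentialFlow_isClassical {V : Set ℝ³} (hV : IsOpen V) {I : Set ℝ} (hI : IsOpen I)
    {φ : ℝ³ → ℝ} (hφ : ContDiffOn ℝ ∞ φ V) (hΔ : ∀ x ∈ V, Δ φ x = 0) {a : ℝ → ℝ} (ha : ContDiffOn ℝ ∞ a I)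
    (ν : ℝ) :
    IsClassicalNSSolutionOnRegion (I ×ˢ V) ν 0 (fun t x => a t • gradient φ x)
      (fun t x => -(deriv a t) * φ x - (a t) ^ 2 * (2⁻¹ * ‖gradient φ x‖ ^ 2)) := by
  rw [isClassicalNSSolutionOnRegion_iff_of_isOpen (hI.prod hV)]
  have ha' : ContDiffOn ℝ ∞ (deriv a) I := ha.deriv_of_isOpen hI (ENat.coe_top_add_one).le
  refine ⟨?_, ?_, ?_, ?_⟩
  · intro z hz
    have ht : z.1 ∈ I := (mem_prod.1 hz).1
    have hx : z.2 ∈ V := (mem_prod.1 hz).2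
    obtain ⟨hF, -, -, -⟩ := harmonic_gradient_identities hV hφ hΔ hx
    exact (((ha.contDiffAt (hI.mem_nhds ht)).comp z contDiffAt_fst).smul (hF.comp z contDiffAt_snd)).contDiffWithinAt
  · intro z hz
    have ht : z.1 ∈ I := (mem_prod.1 hz).1
    have hx : z.2 ∈ V := (mem_prod.1 hz).2
    obtain ⟨hF, -, -, -⟩ := harmonic_gradient_identities hV hφ hΔ hx
    have h1 : ContDiffAt ℝ ∞ (fun w : ℝ × ℝ³ => deriv a w.1) z := (ha'.contDiffAt (hI.mem_nhds ht)).comp z contDiffAt_fst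
    have h2 : ContDiffAt ℝ ∞ (fun w : ℝ × ℝ³ => a w.1) z := (ha.contDiffAt (hI.mem_nhds ht)).comp z contDiffAt_fst
    have h3 : ContDiffAt ℝ ∞ (fun w : ℝ × ℝ³ => φ w.2) z := (hφ.contDiffAt (hV.mem_nhds hx)).comp z contDiffAt_snd
    have h4 : ContDiffAt ℝ ∞ (fun w : ℝ × ℝ³ => gradient φ w.2) z := hF.comp z contDiffAt_snd
    exact ((h1.neg.mul h3).sub ((h2.pow 2).mul (contDiffAt_const.mul (h4.norm_sq ℝ)))).contDiffWithinAt
  · intro t x hz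
    have ht : t ∈ I := (mem_prod.1 hz).1
    have hx : x ∈ V := (mem_prod.1 hz).2
    obtain ⟨hF, -, hΔF, hconv⟩ := harmonic_gradient_identities hV hφ hΔ hx
    have hFd : DifferentiableAt ℝ (gradient φ) x := hF.differentiableAt (by simp)
    have hD : HasFDerivAt (gradient φ) (fderiv ℝ (gradient φ) x) x := hFd.hasFDerivAt
    have had : HasDerivAt a (deriv a t) t :=
      ((ha.differentiableOn (by simp)).differentiableAt (hI.mem_nhds ht)).hasDerivAt
    have h1 : deriv (fun s => a s • gradient φ x) t = deriv a t • gradient φ x := (had.smul_const _).deriv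
    have h2 : convect (fun y => a t • gradient φ y) (fun y => a t • gradient φ y) x =
        (a t * a t) • gradient (fun y => 2⁻¹ * ‖gradient φ y‖ ^ 2) x := by
      rw [convect, show (fun y => a t • gradient φ y) = (a t) • gradient φ from rfl, (hD.const_smul (a t)).fderiv]
      simp only [FunLike.coe_smul, Pi.smul_apply, map_smul, smul_smul]
      rw [← hconv, convect]
    have h3 : Δ (fun y => a t • gradient φ y) x = 0 := by
      show Δ ((a t) • gradient φ) x = 0
      rw [InnerProductSpace.laplacian_smul _ (contDiffAt_infty.1 hF 2), hΔF, smul_zero]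
    have hφd : HasFDerivAt φ (fderiv ℝ φ x) x :=
      ((hφ.contDiffAt (hV.mem_nhds hx)).differentiableAt (by simp)).hasFDerivAt
    have hψd : DifferentiableAt ℝ (fun y => 2⁻¹ * ‖gradient φ y‖ ^ 2) x := (hFd.norm_sq ℝ).const_mul _
    have hp : HasFDerivAt (fun y => -(deriv a t) * φ y - (a t) ^ 2 * (2⁻¹ * ‖gradient φ y‖ ^ 2))
        ((-(deriv a t)) • fderiv ℝ φ x - (a t) ^ 2 • fderiv ℝ (fun y => 2⁻¹ * ‖gradient φ y‖ ^ 2) x) x :=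
      (hφd.const_mul (-(deriv a t))).sub (hψd.hasFDerivAt.const_mul ((a t) ^ 2))
    have h4 : gradient (fun y => -(deriv a t) * φ y - (a t) ^ 2 * (2⁻¹ * ‖gradient φ y‖ ^ 2)) x =
        (-(deriv a t)) • gradient φ x - (a t) ^ 2 • gradient (fun y => 2⁻¹ * ‖gradient φ y‖ ^ 2) x := by
      show (InnerProductSpace.toDual ℝ ℝ³).symm (fderiv ℝ _ x) = _
      rw [hp.fderiv, map_sub, map_smul, map_smul]
      rfl
    rw [h1, h2, h3, h4]
    simp only [smul_zero, Pi.zero_apply, add_zero, zero_sub, neg_sub, neg_smul, sq]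
    abel
  · intro t x hz
    have hx : x ∈ V := (mem_prod.1 hz).2
    obtain ⟨hF, hdiv, -, -⟩ := harmonic_gradient_identities hV hφ hΔ hx
    have hFd : DifferentiableAt ℝ (gradient φ) x := hF.differentiableAt (by simp)
    rw [VectorCalculus.divergence, show (fun y => a t • gradient φ y) = (a t) • gradient φ from rfl,
      (hFd.hasFDerivAt.const_smul (a t)).fderiv, ContinuousLinearMap.toLinearMap_smul, map_smul,
      ← VectorCalculus.divergence, hdiv, smul_zero]

/-- Hence, for `ν > 0`, Serrin's potential flow is a suitable weak solution on every open `Q ⊆ I × V`.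
[cite: Serrin1962, p. 187 (the example u = a(t)∇h)] -/
theorem serrin_potentialFlow_isSuitable {V : Set ℝ³} (hV : IsOpen V) {I : Set ℝ} (hI : IsOpen I)
    {φ : ℝ³ → ℝ} (hφ : ContDiffOn ℝ ∞ φ V) (hΔ : ∀ x ∈ V, Δ φ x = 0) {a : ℝ → ℝ} (ha : ContDiffOn ℝ ∞ a I)
    {ν : ℝ} (hν : 0 < ν) {Q : Opens (ℝ × ℝ³)} (hQ : (Q : Set (ℝ × ℝ³)) ⊆ I ×ˢ V) :
    IsSuitableWeakSolutionOn Q ν 0 (fun t x => a t • gradient φ x)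
      (fun t x => -(deriv a t) * φ x - (a t) ^ 2 * (2⁻¹ * ‖gradient φ x‖ ^ 2)) :=
  (serrin_potentialFlow_isClassical hV hI hφ hΔ ha ν).isSuitableWeakSolutionOn_of_subset hν hQ

end Literature.Analysis.FluidPDE

end
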